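import Summits.QuantumFields.GaugeBoot.BootstrapCouplingJump
import HarnessLib

/-!
# The certificates of a pinned objective are pure loop-equation multiples with multiplier `1/β` (gauge-boot, L1/L4 supplement)

HONEST FRAMING (cell `pub-gaugeboot`, page 1 of every file): the venture produces certified bounds
on lattice expectations at stated coupling, gauge group, dimension and torus size; NOT a mass gap,
NOT a continuum limit, NOT a string tension; NOT Yang–Mills-summit-bearing (barriers
`FixedCouplingUltralocality`, `PerturbativeInvisibility`). Structural; it certifies no number.

## Content (the dual reading of `BootstrapCouplingJump`)

For a test function `f ∈ V` with zero derivative along the shift `(i, a)` the row element of `f` at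
`(i, a)` is `0 - β • (f S_i')`; so at `β ≠ 0` the pinned objective `P = f S_i'` satisfies
`±P ∈ rowSpace ⊆ certCone` with the SINGLE loop-equation multiplier `∓1/β`:

* ★ `mul_mem_rowSpace_of_hasShiftDeriv_zero` (any lattice), `neg_mem_certCone…`/`mem_certCone…` —
  the exact level-`V` certificates `0 • 1 - P ∈ certCone β` and `P - 0 • 1 ∈ certCone β` at every
  `β ≠ 0`;
* ★★ `pinned_certificates_suN` — `SU(N)` torus: for `f ∈ V_n` supported off the link `i` and every
  `β ≠ 0`, both `0 • 1 - f ∂_{i,a}S` and `f ∂_{i,a}S - 0 • 1` lie in `certConeSuN N β n`, each equal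
  to `(∓β⁻¹) •` ONE row element. The multiplier `β⁻¹` diverges as `β → 0` — the dual face of the
  jump at the exceptional coupling `β = 0` (`BootstrapCouplingJump`, `BootstrapExceptionalCouplingZero`):
  completeness of the certificates (ADDENDUM 10) is not uniform in `β`.

References: folklore.
-/

noncomputable section

open MeasureTheory Filter Topology
open Literature.MathematicalPhysics.QuantumFieldTheory (LatticeRep Edge GaugeConfig wilsonAction wilsonMeasure)
open Literature.MathematicalPhysics.QuantumLattice

namespace Summit.QuantumFields.GaugeBoot

section General

variable {ι : Type*} [DecidableEq ι] {G : Type*} [Group G] [TopologicalSpace G] (r : LatticeRep G)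
  {K : Type*} {k : K → ℝ → G} {S : ι → (ι → G) → ℝ} {β : ℝ}

/-- ★ **A pinned objective is a loop equation divided by `β`.** If `f ∈ V` has zero derivative along
the shift `(i, a)` and `S'` is the polynomial derivative of `S i` along it, then for `β ≠ 0`
`f S' = (-β⁻¹) • (row element of f at (i, a)) ∈ rowSpace β V`. [folklore] -/
theorem mul_mem_rowSpace_of_hasShiftDeriv_zero {V : Set C(ι → G, ℝ)} (hβ : β ≠ 0)
    {f : C(ι → G, ℝ)} (hf : f ∈ V) {i : ι} {a : K} (hfi : HasShiftDeriv k i a f 0) {S' : C(ι → G, ℝ)}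
    (hS'm : S' ∈ polyAlgebra (ι := ι) r)
    (hS'd : ∀ U, HasDerivAt (fun t => S i (Function.update U i (k a t * U i))) (S' U) 0) :
    f * S' ∈ rowSpace r k S β V := by
  have hx : (0 : C(ι → G, ℝ)) - β • (f * S') ∈ rowSet r k S β V :=
    ⟨i, a, f, 0, S', hf, Subalgebra.zero_mem _, hS'm, hS'd, hfi, rfl⟩
  have h : f * S' = (-β⁻¹) • ((0 : C(ι → G, ℝ)) - β • (f * S')) := by
    rw [zero_sub, smul_neg, neg_smul, neg_neg, smul_smul, inv_mul_cancel₀ hβ, one_smul]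
  rw [h]
  exact Submodule.smul_mem _ _ (Submodule.subset_span hx)

/-- **The exact upper certificate** `0 • 1 - f S' ∈ certCone β` (`β ≠ 0`). -/
theorem zero_smul_one_sub_mem_certCone_of_hasShiftDeriv_zero {V : Set C(ι → G, ℝ)} (hβ : β ≠ 0)
    {f : C(ι → G, ℝ)} (hf : f ∈ V) {i : ι} {a : K} (hfi : HasShiftDeriv k i a f 0) {S' : C(ι → G, ℝ)}
    (hS'm : S' ∈ polyAlgebra (ι := ι) r)
    (hS'd : ∀ U, HasDerivAt (fun t => S i (Function.update U i (k a t * U i))) (S' U) 0) :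
    (0 : ℝ) • (1 : C(ι → G, ℝ)) - f * S' ∈ certCone r k S β V := by
  rw [zero_smul, zero_sub]
  exact mem_certCone_of_mem_rowSpace r
    ((rowSpace r k S β V).neg_mem (mul_mem_rowSpace_of_hasShiftDeriv_zero r hβ hf hfi hS'm hS'd))

/-- **The exact lower certificate** `f S' - 0 • 1 ∈ certCone β` (`β ≠ 0`). -/
theorem mul_sub_zero_smul_one_mem_certCone_of_hasShiftDeriv_zero {V : Set C(ι → G, ℝ)} (hβ : β ≠ 0)
    {f : C(ι → G, ℝ)} (hf : f ∈ V) {i : ι} {a : K} (hfi : HasShiftDeriv k i a f 0) {S' : C(ι → G, ℝ)}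
    (hS'm : S' ∈ polyAlgebra (ι := ι) r)
    (hS'd : ∀ U, HasDerivAt (fun t => S i (Function.update U i (k a t * U i))) (S' U) 0) :
    f * S' - (0 : ℝ) • (1 : C(ι → G, ℝ)) ∈ certCone r k S β V := by
  rw [zero_smul, sub_zero]
  exact mem_certCone_of_mem_rowSpace r (mul_mem_rowSpace_of_hasShiftDeriv_zero r hβ hf hfi hS'm hS'd)

end General

/-! ## `SU(N)` on the torus -/

section SuN

variable {d L : ℕ} [NeZero L] (N : ℕ)

/-- ★★ **The pinned objective's exact certificates at `β ≠ 0`.** `SU(N)`, torus, level `n`,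
`f ∈ V_n` supported on links avoiding `i`: both `0 • 1 - f ∂_{i,a}S` and `f ∂_{i,a}S - 0 • 1` have
level-`n` certificates at every `β ≠ 0` — pure loop-equation multiples, `f ∂_{i,a}S = -β⁻¹ • row`,
whose multiplier diverges as `β → 0`. [folklore] -/
theorem pinned_certificates_suN {n : ℕ} {β : ℝ} (hβ : β ≠ 0) {T : Set (Edge d L)} {i : Edge d L}
    (hi : i ∉ T) (a : SuGenerator N) {f : C(GaugeConfig d L (Matrix.specialUnitaryGroup (Fin N) ℂ), ℝ)}
    (hf : f ∈ wordSpace (fundamentalLatticeRep N) T n) :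
    (0 : ℝ) • (1 : C(GaugeConfig d L (Matrix.specialUnitaryGroup (Fin N) ℂ), ℝ)) -
        f * torusActionDeriv (fundamentalLatticeRep N) (suExp N) i a ∈ certConeSuN (d := d) (L := L) N β n ∧
      f * torusActionDeriv (fundamentalLatticeRep N) (suExp N) i a -
        (0 : ℝ) • (1 : C(GaugeConfig d L (Matrix.specialUnitaryGroup (Fin N) ℂ), ℝ)) ∈
          certConeSuN (d := d) (L := L) N β n ∧
      f * torusActionDeriv (fundamentalLatticeRep N) (suExp N) i a =
        (-β⁻¹) • ((0 : C(GaugeConfig d L (Matrix.specialUnitaryGroup (Fin N) ℂ), ℝ)) -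
          β • (f * torusActionDeriv (fundamentalLatticeRep N) (suExp N) i a)) := by
  have hfV := mem_wordTruncation_of_mem_wordSpace (fundamentalLatticeRep N) hf
  have hfi := hasShiftDeriv_zero_of_not_mem (fundamentalLatticeRep N) (suExp_add N)
    (X := fun X : SuGenerator N => (X : Matrix (Fin N) (Fin N) ℂ)) (rho_suExp N) hi a hf
  have hS'm := mem_polyAlgebra_of_mem_wordSpace (fundamentalLatticeRep N)
    (torusActionDeriv_mem (fundamentalLatticeRep N) (suExp_add N)
      (X := fun X : SuGenerator N => (X : Matrix (Fin N) (Fin N) ℂ)) (rho_suExp N) i a)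
  have hS'd := hasDerivAt_torusActionDeriv (fundamentalLatticeRep N) (suExp_add N)
    (X := fun X : SuGenerator N => (X : Matrix (Fin N) (Fin N) ℂ)) (rho_suExp N) i a
  refine ⟨zero_smul_one_sub_mem_certCone_of_hasShiftDeriv_zero (fundamentalLatticeRep N) hβ hfV hfi hS'm hS'd,
    mul_sub_zero_smul_one_mem_certCone_of_hasShiftDeriv_zero (fundamentalLatticeRep N) hβ hfV hfi hS'm hS'd, ?_⟩
  rw [zero_sub, smul_neg, neg_smul, neg_neg, smul_smul, inv_mul_cancel₀ hβ, one_smul]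

/-- **Consistency with the primal side**: the two exact certificates recover
`levelValuesSuN N β n (f ∂_{i,a}S) = {0}` at `β ≠ 0` (`levelValues_eq_singleton_zero_suN`) by
soundness. -/
theorem levelValues_subset_singleton_of_pinned_certificates_suN {n : ℕ} {β : ℝ} (hβ : β ≠ 0)
    {T : Set (Edge d L)} {i : Edge d L} (hi : i ∉ T) (a : SuGenerator N)
    {f : C(GaugeConfig d L (Matrix.specialUnitaryGroup (Fin N) ℂ), ℝ)}
    (hf : f ∈ wordSpace (fundamentalLatticeRep N) T n) :
    levelValuesSuN (d := d) (L := L) N β n (f * torusActionDeriv (fundamentalLatticeRep N) (suExp N) i a) ⊆ {0} := by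
  obtain ⟨hup, hlo, -⟩ := pinned_certificates_suN N hβ hi a hf
  rintro t ⟨φ, hφ, rfl⟩
  exact Set.mem_singleton_iff.2 (le_antisymm (hφ.apply_le_of_mem_certCone _ hup)
    (hφ.le_apply_of_mem_certCone _ hlo))

end SuN

end Summit.QuantumFields.GaugeBoot

end
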